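import Mathlib
import Literature.Computability.AlgebraicComplexity.ASSS16GcdTrickFormulas
import Literature.Computability.AlgebraicComplexity.ASSS16RecursionBound
import HarnessLib

/-!
# [ASSS16] Lemma 4.2 (`lem:descent-jacobian`, "evolution via factoring") — the level/Jacobian
# assembly on the FSV occur-`k` formula model

Agrawal–Saha–Saptharishi–Saxena, *Jacobian hits circuits* [ASSS16] (arXiv:1111.0582; STOC 2012),
§4 Lemma 4.2 = Appendix §7.3 `lem:descent-jacobian` (locator: paper:arxiv-1111.0582 p0010.txt:L12–L33,
p0018.txt:L72–L130, p0019.txt:L1–L13). Printed: "Let `𝒰` be a set of `r_ℓ` derivatives (of orders up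
to `c_ℓ`) of gates `𝒢_𝒰` at level `ℓ`, and `𝒰'` be a transcendence basis of `𝒰`. Any
`|𝒰'| × |𝒰'|` minor of `𝒥_x(𝒰')` is of the form `∏_i V_i^{e_i}`, where `V_i`'s are polynomials in at
most `r_{ℓ+1} := (c_ℓ+1) · 2^{c_ℓ+1} k · r_ℓ²` many derivatives (of order up to `c_{ℓ+1} := c_ℓ + 1`)
of disjoint groups of children of `𝒢_𝒰`." Proof (§7.3): for each gate `G` take `V_G` common from
its `e_G` rows by Lemma 4.1 (the gcd trick), leaving entries `Δ_{S_i} G'`; "`Δ_{S_i}G'` is a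
polynomial in the children of `G'` and their at most `(2^{c_ℓ+1} - 1)·k(c_ℓ+1)` many derivatives";
"`det(M)` can be expressed as a product `∏_G V_G^{e_G}` and a polynomial `V` in at most
`k(r_ℓ c_ℓ + r_ℓ²) + r_ℓ²·(2^{c_ℓ+1} - 1)k(c_ℓ+1) ≤ (c_ℓ+1)2^{c_ℓ+1} k r_ℓ²` derivatives (of order up to
`c_ℓ + 1`) of a group of gates in level `ℓ + 1`".

## What is typed here (RULINGS (34)(c)/(35) of the val-lit cell: the formula-model assembly on top of
## the polynomial algebra `ASSS16DerivativeAlgebra` and the formula-level gcd trick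
## `ASSS16GcdTrickFormulas`, val-lit t21)

In the GENERATOR form of §4 needed for FSV Thm. 48 (`FSV2018_thm48_topFanIn`, the abstract sparse
block `Φ` hits every bottom-level minor at once) neither the "disjoint groups" clause nor the global
level structure of `C` is used: occur-`k`, size `≤ s` and depth `≤ d` are PER-GATE properties
inherited by sub-formulas, so a "level" is just a finite family of occur formulas obeying these
resource bounds, a leaf above the bottom level persists to the next level as its own child, and the
rows of the minor are factored ONE ROW AT A TIME (`W_u = var(T_u) ∪ {x_v}`, `|W_u| ≤ c + r`), which
reproduces the printed count exactly.

* `ASSS16.descentRow` — one row: `∂_{x_v} Δ_T G = V · (row_v)` with `V = ∏_{j ∉ P} H_j^{e_j}` a power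
  product of children of `G` free of `W`, every `row_v` a polynomial in the `≤ k(c+r)` kept children
  `H_j`, `j ∈ P`, and their derivatives `Δ_γ H_j`, `0 ≠ γ ≤ x_{v'} + T`, involving every variable of `γ`.
* `ASSS16.descentJacobian` — **Lemma 4.2**: for a family `U_u = Δ_{T_u} G_u` (`|T_u| ≤ c`, gates with
  occur `≤ k`, size `≤ s`, depth `≤ d`) and any `r × r` Jacobian sub-matrix,
  `det = (∏_j K_j^{e_j}) · V` with the `K_j` sub-formulas of depth `≤ d - 1` (the `V_G`'s) and `V` a
  polynomial in `m' ≤ k(rc + r²) + r²(2^{c+1} - 1)k(c+1) ≤ (c+1)2^{c+1}kr²` derivatives of order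
  `≤ c + 1` of sub-formulas of depth `≤ max (d-1) 2` with occur `≤ k`, size `≤ s` (the next level).
* `ASSS16.one_le_of_det_ne_zero` — a non-empty non-zero minor forces `k ≥ 1` (so the next level's
  budget `r_{ℓ+1} = (c_ℓ+1)2^{c_ℓ+1}k r_ℓ²` is `≥ 1` whenever the `V_G` factors matter);
  `ASSS16.level_count_le_asssRec_succ` — the count as one step of F1's `asssRec`;
  `ASSS16.lemma_4_2` — `descentJacobian` in the binder shape of the keystone's hypothesis `hL42`.
* `ASSS16.map_prod_pow_ne_zero_of_ne_zero` — transfer of non-vanishing of the factor `∏_j K_j^{e_j}`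
  along a ring map into a domain, needing the factors preserved only when they are non-zero (the
  exponent-`0` factors of `+` rows may vanish; companion of `ASSS16.map_prod_pow_ne_zero` of
  `ASSS16DescentFaithful`, which asks every factor to be preserved).

Honest framing: bookkeeping toward the val-lit N1 bypass of FSV Thm. 48 (plan
HOME/np/p1g3-THM48-provenance-and-plan.md, F2/F4); `VP ≠ VNP` is NOT proved and nothing here bears on it.

## References
* [AgrawalEtAl2011] arXiv:1111.0582, §4 Lemma 4.2 / §7.3 `lem:descent-jacobian` (locator:
  paper:arxiv-1111.0582 p0010.txt:L12–L33; p0018.txt:L72–L130; p0019.txt:L1–L13).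
* [ForbesShpilkaVolk2018] Def. 45 (seq.) = ToC Def. 5.21 — the occur-`k` formula model.
-/

noncomputable section

namespace Literature.Computability.AlgebraicComplexity

namespace ASSS16

open MvPolynomial Finset

open scoped BigOperators

open Literature.RepresentationTheory.AlgebraicGroups (iterPderiv iterPderiv_zero)

variable {F : Type*} [Field F] {ι : Type*} [DecidableEq ι]

/-! ### Small multiset bookkeeping -/

omit [DecidableEq ι] in
/-- `|var(S)| ≤ |S|`: the support of a multiset of variables is at most its size.
[cite: AgrawalEtAl2011, Lemma 4.2 (= lem:descent-jacobian), proof ("`|∪ var(S_i)| ≤ e_G·c_ℓ + |𝒰'|`")]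
locator: paper:arxiv-1111.0582 p0018.txt:L95–L96 -/
theorem card_support_le_degree (T : ι →₀ ℕ) : T.support.card ≤ T.degree := by
  rw [Finsupp.degree_apply, Finset.card_eq_sum_ones]
  exact Finset.sum_le_sum fun i hi => Nat.one_le_iff_ne_zero.mpr (Finsupp.mem_support_iff.mp hi)

omit [DecidableEq ι] in
/-- The multiset `x_v + T` differentiated in the Jacobian entry `∂_{x_v} Δ_T G` is non-empty.
[cite: AgrawalEtAl2011, Lemma 4.2 (= lem:descent-jacobian), proof] locator: paper:arxiv-1111.0582 p0018.txt:L90–L94 -/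
theorem single_add_ne_zero (a : ι) (T : ι →₀ ℕ) : Finsupp.single a 1 + T ≠ 0 := by
  intro h
  have := congrArg (fun f : ι →₀ ℕ => f a) h
  simp only [Finsupp.add_apply, Finsupp.single_eq_same, Finsupp.coe_zero, Pi.zero_apply] at this
  omega

/-- `var(x_v + T) ⊆ var(T) ∪ {x_1, …, x_r}` (the row's variable set `W`).
[cite: AgrawalEtAl2011, Lemma 4.2 (= lem:descent-jacobian), proof] locator: paper:arxiv-1111.0582 p0018.txt:L95–L96 -/
theorem support_single_add_subset {r : ℕ} (x : Fin r → ι) (T : ι →₀ ℕ) (v : Fin r) :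
    (Finsupp.single (x v) 1 + T).support ⊆ T.support ∪ Finset.univ.image x := by
  intro i hi
  rw [Finsupp.mem_support_iff, Finsupp.add_apply, Finsupp.single_apply] at hi
  by_cases h : x v = i
  · exact Finset.mem_union_right _ (Finset.mem_image.mpr ⟨v, Finset.mem_univ _, h⟩)
  · rw [if_neg h, zero_add] at hi
    exact Finset.mem_union_left _ (Finsupp.mem_support_iff.mpr hi)

/-- `|var(T) ∪ {x_1, …, x_r}| ≤ c + r` for `|T| ≤ c`.
[cite: AgrawalEtAl2011, Lemma 4.2 (= lem:descent-jacobian), proof ("`≤ e_G · c_ℓ + r_ℓ`", one row at a time)]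
locator: paper:arxiv-1111.0582 p0018.txt:L95–L96 -/
theorem card_support_union_image_le {r c : ℕ} (x : Fin r → ι) {T : ι →₀ ℕ} (hc : T.degree ≤ c) :
    (T.support ∪ Finset.univ.image x).card ≤ c + r := by
  refine (Finset.card_union_le _ _).trans (add_le_add ((card_support_le_degree T).trans hc) ?_)
  exact Finset.card_image_le.trans (by rw [Finset.card_univ, Fintype.card_fin])

/-! ### One row of the minor (Lemma 4.1 applied to the gate of the row) -/

/-- **[ASSS16] Lemma 4.2, one row.** Let `G` be a gate of an occur-`k` formula (occur `≤ k`, size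
`≤ s`, depth `≤ d`), `T` a multiset of variables with `|T| ≤ c`, and `x_1, …, x_r` the column
variables (`r ≥ 1`, `k ≥ 1`). Then there are an indexed family of sub-formulas `H_j` (the children of
`G`; for a leaf, `G` itself), exponents `e_j`, the set `P` of kept children (those involving a
variable of `W = var(T) ∪ {x_v}`; `|P| ≤ k(c + r)`, and every variable lies in at most `k` of them)
and polynomials `row_v` with `∂_{x_v} Δ_T G = (∏_{j ∉ P} H_j^{e_j}) · row_v` ("take `V_G` common"),
each `row_v` a polynomial in the kept children and their derivatives `Δ_γ H_j`, `0 ≠ γ ≤ x_{v'} + T`,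
involving every variable of `γ` ("`Δ_{S_i}G'` is a polynomial in the children of `G'` and their …
derivatives (of order between one and `c_ℓ+1`)"); the `H_j` have occur `≤ k`, size `≤ s`, depth
`≤ max (d-1) 2`, and the discarded ones depth `+ 1 ≤ d`.
[cite: AgrawalEtAl2011, Lemma 4.2 (= lem:descent-jacobian), proof (rows of one gate) with Lemma 4.1]
locator: paper:arxiv-1111.0582 p0018.txt:L86–L127 -/
theorem descentRow {k s d c r : ℕ} (hk1 : 1 ≤ k) (hr : 1 ≤ r) (G : OccurFormula F ι) (T : ι →₀ ℕ)
    (hk : ∀ i, G.occur i ≤ k) (hs : G.size ≤ s) (hd : G.depth ≤ d) (hc : T.degree ≤ c)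
    (x : Fin r → ι) :
    ∃ (m : ℕ) (φ : Fin m → OccurFormula F ι) (e : Fin m → ℕ) (P : Finset (Fin m))
      (row : Fin r → MvPolynomial ι F),
      (∀ v, pderiv (x v) (iterPderiv (A := F) T G.eval) = (∏ j ∈ Pᶜ, (φ j).eval ^ e j) * row v) ∧
      (∀ v, row v ∈ Algebra.adjoin F
        ({f | ∃ j ∈ P, f = (φ j).eval} ∪
         {f | ∃ j ∈ P, ∃ v' : Fin r, ∃ γ : ι →₀ ℕ, γ ≠ 0 ∧ γ ≤ Finsupp.single (x v') 1 + T ∧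
            (∀ i ∈ γ.support, i ∈ (φ j).eval.vars) ∧ f = iterPderiv (A := F) γ (φ j).eval})) ∧
      P.card ≤ k * (c + r) ∧
      (∀ i, (P.filter fun j => i ∈ (φ j).eval.vars).card ≤ k) ∧
      (∀ j, (∀ i, (φ j).occur i ≤ k) ∧ (φ j).size ≤ s ∧ (φ j).depth ≤ max (d - 1) 2) ∧
      (∀ j, j ∉ P → (φ j).depth + 1 ≤ d) := by
  classical
  have hW := card_support_union_image_le x hc
  set W : Finset ι := T.support ∪ Finset.univ.image x with hWdef
  cases G with
  | leaf p =>
    refine ⟨1, fun _ => OccurFormula.leaf p, fun _ => 1, Finset.univ,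
      fun v => iterPderiv (A := F) (Finsupp.single (x v) 1 + T) p, fun v => ?_, fun v => ?_, ?_,
      fun i => ?_, fun j => ⟨hk, hs, ?_⟩, fun j hj => absurd (Finset.mem_univ j) hj⟩
    · rw [Finset.compl_univ, Finset.prod_empty, one_mul, OccurFormula.eval, pderiv_iterPderiv]
    · show iterPderiv (A := F) (Finsupp.single (x v) 1 + T) p ∈ _
      by_cases hall : ∀ i ∈ (Finsupp.single (x v) 1 + T).support, i ∈ p.vars
      · refine Algebra.subset_adjoin (Or.inr ⟨0, Finset.mem_univ _, v, _, single_add_ne_zero _ _,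
          le_rfl, ?_, ?_⟩)
        · intro i hi; rw [OccurFormula.eval]; exact hall i hi
        · rw [OccurFormula.eval]
      · push Not at hall
        obtain ⟨i, hi, hip⟩ := hall
        rw [iterPderiv_eq_zero_of_notMem_vars hi hip]
        exact Subalgebra.zero_mem _
    · rw [Finset.card_univ, Fintype.card_fin]
      calc 1 = 1 * 1 := rfl
        _ ≤ k * (c + r) := Nat.mul_le_mul hk1 (by omega)
    · calc (Finset.univ.filter fun j : Fin 1 => i ∈ (OccurFormula.leaf p : OccurFormula F ι).eval.vars).card
          ≤ (Finset.univ : Finset (Fin 1)).card := Finset.card_filter_le _ _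
        _ = 1 := by rw [Finset.card_univ, Fintype.card_fin]
        _ ≤ k := hk1
    · rw [OccurFormula.depth]; exact le_max_right _ _
  | add as =>
    obtain ⟨m, φ, hev, hocc, hsz, hdp, hcard, -, hder⟩ := gcdTrick_add as hk W
    refine ⟨m, φ, fun _ => 0, Finset.univ.filter (fun j => ∃ i ∈ W, i ∈ (φ j).eval.vars),
      fun v => ∑ j ∈ Finset.univ.filter (fun j => ∃ i ∈ W, i ∈ (φ j).eval.vars),
        iterPderiv (A := F) (Finsupp.single (x v) 1 + T) (φ j).eval,
      fun v => ?_, fun v => ?_, hcard.trans (Nat.mul_le_mul_left k hW), fun i => ?_, fun j => ?_,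
      fun j hj => ?_⟩
    · simp only [pow_zero, Finset.prod_const_one, one_mul]
      rw [OccurFormula.eval, pderiv_iterPderiv]
      exact hder _ (single_add_ne_zero _ _) ((support_single_add_subset x T v).trans le_rfl)
    · refine Subalgebra.sum_mem _ fun j hj => ?_
      by_cases hall : ∀ i ∈ (Finsupp.single (x v) 1 + T).support, i ∈ (φ j).eval.vars
      · exact Algebra.subset_adjoin (Or.inr ⟨j, hj, v, _, single_add_ne_zero _ _, le_rfl, hall, rfl⟩)
      · push Not at hall
        obtain ⟨i, hi, hip⟩ := hall
        rw [iterPderiv_eq_zero_of_notMem_vars hi hip]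
        exact Subalgebra.zero_mem _
    · exact (Finset.card_le_card (Finset.filter_subset_filter _ (Finset.subset_univ _))).trans
        (OccurArgs.card_filter_mem_vars_le as φ hocc hk i)
    · refine ⟨fun i => ?_, ?_, ?_⟩
      · have h1 := hk i
        rw [OccurFormula.occur, hocc] at h1
        exact (Finset.single_le_sum (fun j _ => Nat.zero_le _) (Finset.mem_univ j)).trans h1
      · rw [OccurFormula.size, hsz] at hs
        exact (Finset.single_le_sum (f := fun j => (φ j).size) (fun j _ => Nat.zero_le _)
          (Finset.mem_univ j)).trans (by omega)
      · rw [OccurFormula.depth] at hd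
        exact le_max_of_le_left (by have := hdp j; omega)
    · rw [OccurFormula.depth] at hd
      have := hdp j; omega
  | powProd ps =>
    obtain ⟨m, φ, e, hev, hocc, hsz, hdp, hcard, -, hder⟩ := gcdTrick_powProd ps hk W
    refine ⟨m, φ, e, Finset.univ.filter (fun j => ∃ i ∈ W, i ∈ (φ j).eval.vars),
      fun v => iterPderiv (A := F) (Finsupp.single (x v) 1 + T)
        (∏ j ∈ Finset.univ.filter (fun j => ∃ i ∈ W, i ∈ (φ j).eval.vars), (φ j).eval ^ e j),
      fun v => ?_, fun v => ?_, hcard.trans (Nat.mul_le_mul_left k hW), fun i => ?_, fun j => ?_,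
      fun j hj => ?_⟩
    · rw [OccurFormula.eval, pderiv_iterPderiv, Finset.compl_filter]
      exact hder _ ((support_single_add_subset x T v).trans le_rfl)
    · refine (Algebra.adjoin_mono ?_) (iterPderiv_prod_pow_mem_adjoin_refined _ (fun j => (φ j).eval)
        e (Finsupp.single (x v) 1 + T))
      rintro f (⟨j, hj, rfl⟩ | ⟨j, hj, γ, hγ0, hγ, hall, rfl⟩)
      · exact Or.inl ⟨j, hj, rfl⟩
      · exact Or.inr ⟨j, hj, v, γ, hγ0, hγ, hall, rfl⟩
    · exact (Finset.card_le_card (Finset.filter_subset_filter _ (Finset.subset_univ _))).trans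
        (OccurPowArgs.card_filter_mem_vars_le ps φ hocc hk i)
    · refine ⟨fun i => ?_, ?_, ?_⟩
      · have h1 := hk i
        rw [OccurFormula.occur, hocc] at h1
        exact (Finset.single_le_sum (fun j _ => Nat.zero_le _) (Finset.mem_univ j)).trans h1
      · rw [OccurFormula.size, hsz] at hs
        exact le_trans (le_trans (Nat.le_add_left _ _)
          (Finset.single_le_sum (f := fun j => e j + (φ j).size) (fun j _ => Nat.zero_le _)
            (Finset.mem_univ j))) hs
      · rw [OccurFormula.depth] at hd
        exact le_max_of_le_left (by have := hdp j; omega)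
    · rw [OccurFormula.depth] at hd
      have := hdp j; omega

/-! ### Lemma 4.2: the factorisation of a Jacobian minor of a level -/

/-- **Transfer of the `V_G` factor** (how Cor. 4.3 / the recursion uses "`∏_G V_G^{e_G}`"): a ring
map into a domain that kills no NON-ZERO `K_j` kills no non-zero power product `∏_j K_j^{e_j}`
(factors with exponent `0` may themselves vanish). [cite: AgrawalEtAl2011, Lemma 4.2 (= lem:descent-jacobian) with Cor. 4.3]
locator: paper:arxiv-1111.0582 p0010.txt:L12–L33 -/
theorem map_prod_pow_ne_zero_of_ne_zero {R S : Type*} [CommRing R] [CommRing S] [IsDomain S] {n : ℕ}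
    (ψ : R →+* S) (a : Fin n → R) (e : Fin n → ℕ) (h : ∀ j, a j ≠ 0 → ψ (a j) ≠ 0)
    (hne : ∏ j, a j ^ e j ≠ 0) : ψ (∏ j, a j ^ e j) ≠ 0 := by
  rw [map_prod]
  refine Finset.prod_ne_zero_iff.mpr fun j _ => ?_
  rw [map_pow]
  rcases Nat.eq_zero_or_pos (e j) with h0 | hpos
  · rw [h0, pow_zero]; exact one_ne_zero
  · refine pow_ne_zero _ (h j fun hj => hne ?_)
    exact Finset.prod_eq_zero (Finset.mem_univ j) (by rw [hj, zero_pow (Nat.pos_iff_ne_zero.mp hpos)])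

/-- **[ASSS16] Lemma 4.2 (`lem:descent-jacobian`, evolution via factoring) on the formula model.**
Let `U_u = Δ_{T_u} G_u` (`u < m`) be derivatives of orders `|T_u| ≤ c` of gates `G_u` of occur-`k`
formulas (occur `≤ k`, size `≤ s`, depth `≤ d`; repetitions allowed), and consider any `r × r`
sub-matrix `(∂_{x_v} U_{ρ u})_{u,v}` of their Jacobian. Then
`det = (∏_j K_j^{e_j}) · V` where the `K_j` are sub-formulas of depth `+ 1 ≤ d` (occur `≤ k`, size
`≤ s`) — "`∏_{G ∈ 𝒢_𝒰} V_G^{e_G}`" — and `V` is a polynomial in `m' ≤ k(rc + r²) + r²(2^{c+1}-1)k(c+1)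
≤ (c+1)·2^{c+1}·k·r²` derivatives `Δ_{T'_j} H_j` of orders `|T'_j| ≤ c + 1` of sub-formulas `H_j`
of depth `≤ max (d-1) 2` (occur `≤ k`, size `≤ s`) — "a polynomial `V` in at most …
`(c_ℓ+1)2^{c_ℓ+1} k r_ℓ²` derivatives (of order up to `c_ℓ + 1`) of a group of gates in level
`ℓ + 1`". (Generator form: the "disjoint groups" clause is not needed and not asserted; for `r ≤ r_ℓ`
the bound is one step of `asssRec`.) [cite: AgrawalEtAl2011, Lemma 4.2 (= lem:descent-jacobian)]
locator: paper:arxiv-1111.0582 p0010.txt:L12–L21; p0018.txt:L72–L130; p0019.txt:L1–L13 -/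
theorem descentJacobian {k s d c m r : ℕ} (G : Fin m → OccurFormula F ι) (T : Fin m → ι →₀ ℕ)
    (hk : ∀ u i, (G u).occur i ≤ k) (hs : ∀ u, (G u).size ≤ s) (hd : ∀ u, (G u).depth ≤ d)
    (hc : ∀ u, (T u).degree ≤ c) (ρ : Fin r → Fin m) (x : Fin r → ι) :
    ∃ (mV : ℕ) (K : Fin mV → OccurFormula F ι) (eV : Fin mV → ℕ)
      (m' : ℕ) (H : Fin m' → OccurFormula F ι) (T' : Fin m' → ι →₀ ℕ) (V : MvPolynomial ι F),
      (Matrix.of fun u v => pderiv (x v) (iterPderiv (A := F) (T (ρ u)) (G (ρ u)).eval)).det =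
          (∏ j, (K j).eval ^ eV j) * V ∧
      V ∈ Algebra.adjoin F (Set.range fun j => iterPderiv (A := F) (T' j) (H j).eval) ∧
      m' ≤ k * (r * c + r ^ 2) + r ^ 2 * (2 ^ (c + 1) - 1) * k * (c + 1) ∧
      m' ≤ (c + 1) * 2 ^ (c + 1) * k * r ^ 2 ∧
      (∀ j, (∀ i, (K j).occur i ≤ k) ∧ (K j).size ≤ s ∧ (K j).depth + 1 ≤ d) ∧
      (∀ j, (∀ i, (H j).occur i ≤ k) ∧ (H j).size ≤ s ∧ (H j).depth ≤ max (d - 1) 2 ∧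
        (T' j).degree ≤ c + 1) := by
  classical
  -- `r = 0`: the empty minor is `1`.
  rcases Nat.eq_zero_or_pos r with rfl | hr
  · refine ⟨0, Fin.elim0, Fin.elim0, 0, Fin.elim0, Fin.elim0, 1, ?_, Subalgebra.one_mem _,
      Nat.zero_le _, Nat.zero_le _, fun j => j.elim0, fun j => j.elim0⟩
    rw [Matrix.det_isEmpty, Finset.univ_eq_empty, Finset.prod_empty, one_mul]
  -- `k = 0`: no variable occurs, every entry vanishes.
  rcases Nat.eq_zero_or_pos k with rfl | hk1
  · haveI : Nonempty (Fin r) := ⟨⟨0, hr⟩⟩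
    have hM : (Matrix.of fun u v =>
        pderiv (x v) (iterPderiv (A := F) (T (ρ u)) (G (ρ u)).eval)) = 0 := by
      refine Matrix.ext fun u v => ?_
      rw [Matrix.of_apply, Matrix.zero_apply, pderiv_iterPderiv]
      refine iterPderiv_eq_zero_of_notMem_vars (R := F) (i := x v) ?_ fun hx => ?_
      · rw [Finsupp.mem_support_iff, Finsupp.add_apply, Finsupp.single_eq_same]; omega
      · have h1 := OccurFormula.one_le_occur_of_mem_vars (x v) (G (ρ u)) hx
        have h2 := hk (ρ u) (x v)
        omega
    refine ⟨0, Fin.elim0, Fin.elim0, 0, Fin.elim0, Fin.elim0, 0, ?_, Subalgebra.zero_mem _,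
      Nat.zero_le _, Nat.zero_le _, fun j => j.elim0, fun j => j.elim0⟩
    rw [hM, Matrix.det_zero, mul_zero]
  -- Main case: factor every row by Lemma 4.1.
  have hrow := fun u : Fin r =>
    descentRow (F := F) hk1 hr (G (ρ u)) (T (ρ u)) (hk (ρ u)) (hs (ρ u)) (hd (ρ u)) (hc (ρ u)) x
  choose mr φ e P row hfac hmem hPcard hPfil hbnd hdisc using hrow
  -- Index types: discarded children (the `V_G` factors); kept children and
  -- (column, order `0 ≠ γ ≤ x_v + T_u`, kept child involving every variable of `γ`) (the next level).
  let κV : Type := Σ u : Fin r, {j : Fin (mr u) // j ∉ P u}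
  let KV : κV → OccurFormula F ι := fun q => φ q.1 q.2
  let eVV : κV → ℕ := fun q => e q.1 q.2
  let Γ : Fin r → Fin r → Finset (ι →₀ ℕ) := fun u v =>
    (Finset.Iic (Finsupp.single (x v) 1 + T (ρ u))).filter fun γ => γ ≠ 0
  let A : Fin r → Type := fun u => {j : Fin (mr u) // j ∈ P u}
  let B : Fin r → Type _ := fun u => Σ v : Fin r, Σ γ : {γ : ι →₀ ℕ // γ ∈ Γ u v},
    {j : Fin (mr u) // j ∈ (P u).filter fun j => ∀ i ∈ (γ : ι →₀ ℕ).support, i ∈ (φ u j).eval.vars}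
  let κ : Type _ := Σ u : Fin r, (A u ⊕ B u)
  let HH : κ → OccurFormula F ι := fun q =>
    Sum.elim (fun j : A q.1 => φ q.1 j) (fun t : B q.1 => φ q.1 t.2.2) q.2
  let TT : κ → ι →₀ ℕ := fun q =>
    Sum.elim (fun _ : A q.1 => (0 : ι →₀ ℕ)) (fun t : B q.1 => (t.2.1 : ι →₀ ℕ)) q.2
  let V : MvPolynomial ι F := (Matrix.of fun u v => row u v).det
  -- (1) the factorisation
  have hMN : ∀ u v, (Matrix.of fun u v =>
      pderiv (x v) (iterPderiv (A := F) (T (ρ u)) (G (ρ u)).eval)) u v =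
        (∏ j ∈ (P u)ᶜ, (φ u j).eval ^ e u j) * (Matrix.of fun u v => row u v) u v := fun u v => by
    rw [Matrix.of_apply, Matrix.of_apply]; exact hfac u v
  have hdet : (Matrix.of fun u v =>
      pderiv (x v) (iterPderiv (A := F) (T (ρ u)) (G (ρ u)).eval)).det =
        (∏ q : κV, (KV q).eval ^ eVV q) * V := by
    rw [det_eq_prod_mul_det_of_row_factor _ _ _ hMN]
    congr 1
    rw [Fintype.prod_sigma]
    refine Finset.prod_congr rfl fun u _ => ?_
    exact Finset.prod_subtype ((P u)ᶜ) (fun j => Finset.mem_compl) (fun j => (φ u j).eval ^ e u j)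
  -- (2) `V` is a polynomial in the generators of the next level
  have hV : V ∈ Algebra.adjoin F (Set.range fun q : κ => iterPderiv (A := F) (TT q) (HH q).eval) := by
    refine det_mem_subalgebra _ _ fun u v => ?_
    rw [Matrix.of_apply]
    refine (Algebra.adjoin_mono ?_) (hmem u v)
    rintro f (⟨j, hj, rfl⟩ | ⟨j, hj, v', γ, hγ0, hγ, hall, rfl⟩)
    · refine ⟨⟨u, Sum.inl ⟨j, hj⟩⟩, ?_⟩
      show iterPderiv (A := F) 0 (φ u j).eval = (φ u j).eval
      rw [iterPderiv_zero, LinearMap.id_apply]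
    · have hγmem : γ ∈ Γ u v' := Finset.mem_filter.mpr ⟨Finset.mem_Iic.mpr hγ, hγ0⟩
      have hjmem : j ∈ (P u).filter fun j => ∀ i ∈ (γ : ι →₀ ℕ).support, i ∈ (φ u j).eval.vars :=
        Finset.mem_filter.mpr ⟨hj, hall⟩
      exact ⟨⟨u, Sum.inr ⟨v', ⟨γ, hγmem⟩, ⟨j, hjmem⟩⟩⟩, rfl⟩
  -- (3) the count `|κ| ≤ k(rc + r²) + r²(2^{c+1} - 1)k(c+1)`
  have hΓ : ∀ u v, (Γ u v).card ≤ 2 ^ (c + 1) - 1 := fun u v => by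
    refine (card_Iic_filter_ne_zero_le _).trans (Nat.sub_le_sub_right ?_ 1)
    refine Nat.pow_le_pow_right (by norm_num) ?_
    rw [degree_single_add]
    have := hc (ρ u); omega
  have hB : ∀ u, Fintype.card (B u) ≤ r * ((2 ^ (c + 1) - 1) * k) := fun u => by
    show Fintype.card (Σ v : Fin r, Σ γ : {γ : ι →₀ ℕ // γ ∈ Γ u v},
      {j : Fin (mr u) // j ∈ (P u).filter fun j =>
        ∀ i ∈ (γ : ι →₀ ℕ).support, i ∈ (φ u j).eval.vars}) ≤ _
    rw [Fintype.card_sigma]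
    calc ∑ v : Fin r, Fintype.card (Σ γ : {γ : ι →₀ ℕ // γ ∈ Γ u v},
            {j : Fin (mr u) // j ∈ (P u).filter fun j =>
              ∀ i ∈ (γ : ι →₀ ℕ).support, i ∈ (φ u j).eval.vars})
        ≤ ∑ _v : Fin r, (2 ^ (c + 1) - 1) * k := Finset.sum_le_sum fun v _ => by
          rw [Fintype.card_sigma]
          calc ∑ γ : {γ : ι →₀ ℕ // γ ∈ Γ u v}, Fintype.card
                  {j : Fin (mr u) // j ∈ (P u).filter fun j =>
                    ∀ i ∈ (γ : ι →₀ ℕ).support, i ∈ (φ u j).eval.vars}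
              ≤ ∑ _γ : {γ : ι →₀ ℕ // γ ∈ Γ u v}, k := Finset.sum_le_sum fun γ _ => by
                  rw [Fintype.card_coe]
                  exact card_filter_forall_mem_vars_le (P u) (fun j => (φ u j).eval) (hPfil u)
                    (Finset.mem_filter.mp γ.2).2
            _ ≤ (2 ^ (c + 1) - 1) * k := by
                  rw [Finset.sum_const, smul_eq_mul, Finset.card_univ, Fintype.card_coe]
                  exact Nat.mul_le_mul_right k (hΓ u v)
      _ = r * ((2 ^ (c + 1) - 1) * k) := by
          rw [Finset.sum_const, smul_eq_mul, Finset.card_univ, Fintype.card_fin]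
  have hcount : Fintype.card κ ≤ k * (r * c + r ^ 2) + r ^ 2 * (2 ^ (c + 1) - 1) * k * (c + 1) := by
    show Fintype.card (Σ u : Fin r, (A u ⊕ B u)) ≤ _
    rw [Fintype.card_sigma]
    calc ∑ u : Fin r, Fintype.card (A u ⊕ B u)
        ≤ ∑ _u : Fin r, (k * (c + r) + r * ((2 ^ (c + 1) - 1) * k)) :=
          Finset.sum_le_sum fun u _ => by
            rw [Fintype.card_sum]
            refine add_le_add ?_ (hB u)
            show Fintype.card {j : Fin (mr u) // j ∈ P u} ≤ _
            rw [Fintype.card_coe]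
            exact hPcard u
      _ = r * (k * (c + r) + r * ((2 ^ (c + 1) - 1) * k)) := by
          rw [Finset.sum_const, smul_eq_mul, Finset.card_univ, Fintype.card_fin]
      _ = k * (r * c + r ^ 2) + r ^ 2 * (2 ^ (c + 1) - 1) * k * 1 := by ring
      _ ≤ k * (r * c + r ^ 2) + r ^ 2 * (2 ^ (c + 1) - 1) * k * (c + 1) :=
          Nat.add_le_add_left (Nat.mul_le_mul_left _ (by omega)) _
  -- (4) the resource bounds of both families
  have hKV : ∀ q : κV, (∀ i, (KV q).occur i ≤ k) ∧ (KV q).size ≤ s ∧ (KV q).depth + 1 ≤ d := by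
    rintro ⟨u, j, hj⟩
    exact ⟨(hbnd u j).1, (hbnd u j).2.1, hdisc u j hj⟩
  have hHT : ∀ q : κ, (∀ i, (HH q).occur i ≤ k) ∧ (HH q).size ≤ s ∧ (HH q).depth ≤ max (d - 1) 2 ∧
      (TT q).degree ≤ c + 1 := by
    rintro ⟨u, j | ⟨v, γ, j⟩⟩
    · refine ⟨(hbnd u j).1, (hbnd u j).2.1, (hbnd u j).2.2, ?_⟩
      show (0 : ι →₀ ℕ).degree ≤ c + 1
      rw [map_zero]; exact Nat.zero_le _
    · refine ⟨(hbnd u j).1, (hbnd u j).2.1, (hbnd u j).2.2, ?_⟩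
      show (γ : ι →₀ ℕ).degree ≤ c + 1
      have hγ : (γ : ι →₀ ℕ) ≤ Finsupp.single (x v) 1 + T (ρ u) :=
        Finset.mem_Iic.mp (Finset.mem_filter.mp γ.2).1
      refine (Finsupp.degree_mono hγ).trans ?_
      rw [degree_single_add]
      have := hc (ρ u); omega
  -- (5) re-index by `Fin`
  let eV := Fintype.equivFin κV
  let eH := Fintype.equivFin κ
  refine ⟨Fintype.card κV, KV ∘ eV.symm, eVV ∘ eV.symm, Fintype.card κ, HH ∘ eH.symm, TT ∘ eH.symm,
    V, ?_, ?_, hcount, hcount.trans (level_count_le k r c), fun j => hKV _, fun j => hHT _⟩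
  · rw [hdet]
    congr 1
    exact Fintype.prod_equiv eV _ _ fun q => by
      simp only [Function.comp_apply, Equiv.symm_apply_apply]
  · have hrange : (Set.range fun j => iterPderiv (A := F) ((TT ∘ eH.symm) j) ((HH ∘ eH.symm) j).eval)
        = Set.range fun q : κ => iterPderiv (A := F) (TT q) (HH q).eval :=
      eH.symm.surjective.range_comp (fun q : κ => iterPderiv (A := F) (TT q) (HH q).eval)
    rw [hrange]
    exact hV

/-! ### Glue for the levels recursion (F4 keystone) -/

/-- **A non-empty non-zero Jacobian minor of a level forces `k ≥ 1`:** if no variable occurred in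
the gates (`k = 0`), every entry `∂_{x_v} Δ_T G` would vanish. (Used to see `r_{ℓ+1} ≥ 1` in the
step of the recursion whenever `V_G` factors are present.)
[cite: AgrawalEtAl2011, Lemma 4.2 (= lem:descent-jacobian), proof] locator: paper:arxiv-1111.0582 p0018.txt:L88–L94 -/
theorem one_le_of_det_ne_zero {k m r : ℕ} (G : Fin m → OccurFormula F ι) (T : Fin m → ι →₀ ℕ)
    (hk : ∀ u i, (G u).occur i ≤ k) (ρ : Fin r → Fin m) (x : Fin r → ι) (hr : 1 ≤ r)
    (hdet : (Matrix.of fun u v =>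
      pderiv (x v) (iterPderiv (A := F) (T (ρ u)) (G (ρ u)).eval)).det ≠ 0) : 1 ≤ k := by
  classical
  by_contra hk0
  have hk0 : k = 0 := by omega
  subst hk0
  haveI : Nonempty (Fin r) := ⟨⟨0, hr⟩⟩
  apply hdet
  have hM : (Matrix.of fun u v =>
      pderiv (x v) (iterPderiv (A := F) (T (ρ u)) (G (ρ u)).eval)) = 0 := by
    refine Matrix.ext fun u v => ?_
    rw [Matrix.of_apply, Matrix.zero_apply, pderiv_iterPderiv]
    refine iterPderiv_eq_zero_of_notMem_vars (R := F) (i := x v) ?_ fun hx => ?_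
    · rw [Finsupp.mem_support_iff, Finsupp.add_apply, Finsupp.single_eq_same]; omega
    · have h1 := OccurFormula.one_le_occur_of_mem_vars (x v) (G (ρ u)) hx
      have h2 := hk (ρ u) (x v)
      omega
  rw [hM, Matrix.det_zero]

/-- **The count of Lemma 4.2 as one step of the recursion `asssRec`** (F1): for a minor of size
`r ≤ r_{2+c}` with orders `≤ c = c_{2+c}`, `(c+1)·2^{c+1}·k·r² ≤ r_{2+c+1}`.
[cite: AgrawalEtAl2011, Lemma 4.2 (= lem:descent-jacobian)] locator: paper:arxiv-1111.0582 p0010.txt:L16–L19 -/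
theorem level_count_le_asssRec_succ {k t c r : ℕ} (hr : r ≤ (asssRec k t c).1) :
    (c + 1) * 2 ^ (c + 1) * k * r ^ 2 ≤ (asssRec k t (c + 1)).1 := by
  rw [asssRec_fst_succ]
  exact Nat.mul_le_mul_left _ (Nat.pow_le_pow_left hr 2)


/-- **[ASSS16] Lemma 4.2 in the binder shape of the keystone's hypothesis `hL42`** (val-lit t18,
AC/FSV18Thm48TopFanInHolds.lean): `ASSS16.descentJacobian` with `m`, `r` explicit and the printed
count only (five conjuncts). [cite: AgrawalEtAl2011, Lemma 4.2 (= lem:descent-jacobian)]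
locator: paper:arxiv-1111.0582 p0010.txt:L12–L21; p0018.txt:L72–L130 -/
theorem lemma_4_2 {k s d c : ℕ} :
    ∀ (m : ℕ) (G : Fin m → OccurFormula F ι) (T : Fin m → ι →₀ ℕ),
      (∀ u i, (G u).occur i ≤ k) → (∀ u, (G u).size ≤ s) → (∀ u, (G u).depth ≤ d) →
      (∀ u, (T u).degree ≤ c) →
      ∀ (r : ℕ) (ρ : Fin r → Fin m) (x : Fin r → ι),
      ∃ (mV : ℕ) (K : Fin mV → OccurFormula F ι) (eV : Fin mV → ℕ)
        (m' : ℕ) (H : Fin m' → OccurFormula F ι) (T' : Fin m' → ι →₀ ℕ) (V : MvPolynomial ι F),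
        (Matrix.of fun u v => pderiv (x v) (iterPderiv (A := F) (T (ρ u)) (G (ρ u)).eval)).det =
            (∏ j, (K j).eval ^ eV j) * V ∧
        V ∈ Algebra.adjoin F (Set.range fun j => iterPderiv (A := F) (T' j) (H j).eval) ∧
        m' ≤ k * (r * c + r ^ 2) + r ^ 2 * (2 ^ (c + 1) - 1) * k * (c + 1) ∧
        (∀ j, (∀ i, (K j).occur i ≤ k) ∧ (K j).size ≤ s ∧ (K j).depth + 1 ≤ d) ∧
        (∀ j, (∀ i, (H j).occur i ≤ k) ∧ (H j).size ≤ s ∧ (H j).depth ≤ max (d - 1) 2 ∧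
          (T' j).degree ≤ c + 1) :=
  fun _ G T hk hs hd hc _ ρ x => by
    obtain ⟨mV, K, eV, m', H, T', V, h1, h2, h3, -, h5, h6⟩ := descentJacobian G T hk hs hd hc ρ x
    exact ⟨mV, K, eV, m', H, T', V, h1, h2, h3, h5, h6⟩

end ASSS16



end Literature.Computability.AlgebraicComplexity
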